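/- Copyright: the b2b-balaban cell (near-miss cell 7), T⁴-continuum fan-out, NE7b swarm leaf 04 (gen 7; road W-RP, sub-row
«W3o» junction file «4t TEMPLATE SIDE»: W3o's template events plugged into W4c's event sides, unit cells and cube cells).
Released under the licence of the surrounding project. -/
import Summits.QuantumFields.BalabanUV.T4Continuum.Support.HistoryRPTowerUniform
import Summits.QuantumFields.BalabanUV.T4Continuum.Support.HistoryChessboardEventsTower
import Summits.QuantumFields.BalabanUV.T4Continuum.Support.HistoryChessboardEventsCubes

/-!
# Road W-RP, junction «4t»: THE TEMPLATE SIDE — W3o's template events in W4c's event sides (unit cells and cube cells)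

Summits-side support leaf of the T⁴-continuum cell (rung (B)+1 on a FINITE torus only; NOT infinite volume, NOT the
mass gap, NOT the Clay statement; NOT a proof of the spine estimate NE7b).  Road W-RP (R-OWNER-23-2 ∕ R-OWNER-23-8) of
the swarm claim table `t4/b2b-balaban-t4-ne7b-p1/LEAVES-NE7b.md`; the junction of sub-row «W3o» (`HistoryRPTowerTemplates`,
leaf-04 g7: `tEvent`, `towerBox`, `tEvent_E_meas`∕`tEvent_loc`∕`tEvent_sym`, the general `measurableSet_tEvent_cutPos` ∕
`preimage_cutRefl_tEvent`; file 3 `HistoryRPTowerUniform`: `axisVec`, `boxUniform`, `boxUniform_sym(_cell)`) with row W4c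
(leaf-06 g6): file 4a's `EventSide`, file 4b's tower-law reading and END
`hybridNE7_of_towerEventSides_SU`, file 4c's cube letters `cubeCut` ∕ `cubeRefl` ∕ `cubePos`.  [folklore] bookkeeping; ONE
hypothesis shape `structure TemplateSide … : Prop` (consumed only as a binder), DATA defs `cubeCutHom`, `cubeCorner`; no
`[cite:]` tag, no `Prop`-valued FACT (c1), no constant (c2∕c6), no exit ∕ socket ∕ `HistoryConstants` file (c3); nothing
printed asserted.

WHAT.
* §1 `structure TemplateSide` = `EventSide` for TEMPLATE EVENTS `E l c := tEvent K (tmpl l) c` (unit cells, `θ := cutRefl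
  K`, `mP := cutPos G K`) with the three event-geometry clauses `E_meas` ∕ `loc` ∕ `sym` REPLACED by the two template
  clauses `tmpl_meas` (reference-column measurability) and `tmpl_sym` (one-set reflection symmetry per axis);
  **`TemplateSide.eventSide`** (the three clauses PRODUCED by W3o), `TemplateSide.cutoffReading_towerLaw_gibbs_SU`, the END
  twin **`hybridNE7_of_towerTemplateSides_SU`** (4b's END over two families of template sides).
* §2 CUBE CELLS (4c's cube torus `BlockIdx P.d N`, `P.sitesPerDir K = M·N`): `cubeCut_add`, `cubeCutHom`, the corner
  site `cubeCorner h c` (`= M·c`), `val_cubeCorner_sub_cutVec`, **`tEvent_loc_cubes`** (`mP := cubePos G h`),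
  `cubeCorner_cellReflect`, **`tEvent_sym_cubes`** (`θ := cubeRefl h`, mirror cube `−M·e_i`), `tEvent_E_meas_cubes` — the
  three `EventSide` clauses for the template events `E l c := tEvent K (tmpl l) (cubeCorner h c)` of the cube torus.
* §3 sanity IN SITU on the `SU(n)` Gibbs tower: `TemplateSide` inhabited; and, HYPOTHESIS-FREE, 4a's `EventSide` for
  the uniform box template `boxUniform P G A K 1 K` (`A` measurable, `A⁻¹ = A`) with `E_meas` ∕ `loc` ∕ `sym` discharged
  by W3o + W3o-3 BY NAME.

HONEST SCOPE (R-OWNER-23-8 wording for road W-RP).  Regrouping only: what stays DISPLAYED for an instantiating seat is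
`TemplateSide` — the (EXT) event model of Bałaban's terms (`repr`, `ev_cover`, `bad_disj`, `bad_sub`, now relative to
TEMPLATE events: which template), (U1)+(G2) `univ_le`, and the two template clauses `tmpl_meas` ∕ `tmpl_sym` for THAT
template (the (LOC)∕(R-sym) sentences as one measurability and one set identity per axis); the typing identification
«`blockAvg ℰ` = (0.4)» is T-class; nothing of H3 ∕ (B) ∕ BetaPertH is discharged; the count 0∕9 is unchanged.  NE7b NOT
proved; spine 0∕9.  HONEST DEPENDENCY (cell): continuum YM on T⁴ ⇐ BetaPertH ∧ nine spine estimates (0/9 proved); BetaPertH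
⇐ (D1) ∧ (D4) ∧ CAP+tail; G-an2-4 gates asym, D1 and NE2/3/4.  This file changes none of it. -/

open Finset MeasureTheory
open Literature.Barriers.CriticalPhenomena.NonGibbs
open Literature.MathematicalPhysics.QuantumFieldTheory
open Literature.MathematicalPhysics.QuantumFieldTheory.Balaban1983to89
open T4UndoubledRP T4IndicatorShell T4MatchingAssembly T4MatchingClosure BlockAveraging T4ReflectionConeSharp
open Summit.QuantumFields.BalabanUV.T4Continuum
open HistoryRPHalfTorus HistoryRPTowerLaw HistoryRPTowerCuts HistoryRPTowerCells HistoryRPTowerTemplates HistoryRPTowerUniform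
open HistoryChessboardEventsCutoff HistoryChessboardEventsSplit HistoryChessboardEventsTower HistoryChessboardEventsCubes

namespace Summit.QuantumFields.BalabanUV.T4Continuum.HistoryChessboardEventsTemplates

noncomputable section

variable {P : Params} {G : Type*}

/-! ## §1 The template side (unit cells); the END over template sides -/

section TemplateSide

variable (P) (G) [GaugeGroup G] [MeasurableSpace G]

/-- **THE TEMPLATE SIDE OF THE TOWER-LAW READING**: W4c's `EventSide` for TEMPLATE EVENTS `E l c := tEvent K (tmpl l) c`
relative to `cutRefl K` ∕ `cutPos G K`, with its three event-geometry clauses `E_meas` ∕ `loc` ∕ `sym` REPLACED by the two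
template clauses `tmpl_meas` (reference-column measurability) and `tmpl_sym` (one-set reflection symmetry per axis) from
which W3o derives them.  A hypothesis SHAPE; NOTHING of Bałaban's is asserted; no citation tag. [folklore] -/
structure TemplateSide {ι Λ : Type*} (K : ℕ) (Pat : Finset Λ) (T : Finset ι) (A : ℝ → ι → ℝ) (Bad : Finset ι)
    (μ : Measure (Tower P G K)) (Z : ℝ) (ev : ι → Set (Tower P G K)) (obs : Tower P G K → ℝ) (ob : ℝ)
    (tmpl : Λ → Set (Tower P G K)) (r : ℝ) : Prop where
  /-- the undressed partition function is positive -/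
  Z_pos : 0 < Z
  /-- the bad class consists of terms -/
  bad_subset : Bad ⊆ T
  /-- term events are measurable -/
  ev_meas : ∀ τ ∈ T, MeasurableSet (ev τ)
  /-- the source observable is measurable … -/
  obs_meas : Measurable obs
  /-- … and bounded by `ob` -/
  obs_bdd : ∀ ω, |obs ω| ≤ ob
  /-- the bound is nonnegative -/
  ob_nonneg : 0 ≤ ob
  /-- (EXT)+(DRESS): the dressed weight of a term is the source-dressed mass of its event -/
  repr : ∀ (t : ℝ), ∀ τ ∈ T, A t τ = Z * ∫ ω in ev τ, Real.exp (t * obs ω) ∂μ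
  /-- the term events exhaust the state -/
  ev_cover : Set.univ ⊆ ⋃ τ ∈ T, ev τ
  /-- (EXT): bad events are pairwise disjoint -/
  bad_disj : (↑Bad : Set ι).PairwiseDisjoint ev
  /-- (EXT)∘(LOC): every bad event lies inside a template event of some pattern at some cell -/
  bad_sub : ∀ τ ∈ Bad, ev τ ⊆ ⋃ l ∈ Pat, ⋃ c : BlockIdx P.d (P.sitesPerDir K), tEvent K (tmpl l) c
  /-- (U1)+(G2), ratio currency: the pattern shown by EVERY column has probability `≤ r^(N^d)` -/
  univ_le : ∀ l ∈ Pat, μ.real (⋂ c ∈ (Finset.univ : Finset (BlockIdx P.d (P.sitesPerDir K))), tEvent K (tmpl l) c) ≤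
    r ^ (P.sitesPerDir K ^ P.d)
  /-- the per-cell rate is nonnegative -/
  r_nonneg : 0 ≤ r
  /-- the templates are measurable in the reference column under the top cell `0` -/
  tmpl_meas : ∀ l ∈ Pat, MeasurableSet[towerBox G K 1 K] (tmpl l)
  /-- the templates have the reflection symmetry of every axis -/
  tmpl_sym : ∀ l ∈ Pat, ∀ i : Fin P.d,
    (towerRefl i K) ⁻¹' tmpl l = (towerTranslate K ((0 : Site P K).unshift i)) ⁻¹' tmpl l

variable {P G} {ι Λ : Type*} {K : ℕ} {Pat : Finset Λ} {T : Finset ι} {A : ℝ → ι → ℝ} {Bad : Finset ι}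
  {μ : Measure (Tower P G K)} {Z : ℝ} {ev : ι → Set (Tower P G K)} {obs : Tower P G K → ℝ} {ob : ℝ}
  {tmpl : Λ → Set (Tower P G K)} {r : ℝ}

/-- **THE TEMPLATE SIDE IS AN EVENT SIDE** (`K ≤ m + P.K`): `E_meas` ∕ `loc` ∕ `sym` by W3o's `tEvent_E_meas` ∕
`tEvent_loc` ∕ `tEvent_sym`, the other twelve clauses verbatim. [folklore] -/
theorem TemplateSide.eventSide (hK : K ≤ P.m + P.K) (H : TemplateSide P G K Pat T A Bad μ Z ev obs ob tmpl r) :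
    EventSide P.d (P.sitesPerDir K) Pat T A Bad μ Z ev obs ob (fun l c => tEvent K (tmpl l) c) (cutRefl K)
      (cutPos G K) r where
  Z_pos := H.Z_pos
  bad_subset := H.bad_subset
  ev_meas := H.ev_meas
  E_meas := tEvent_E_meas fun l hl => measurableSet_of_towerBox (H.tmpl_meas l hl)
  obs_meas := H.obs_meas
  obs_bdd := H.obs_bdd
  ob_nonneg := H.ob_nonneg
  repr := H.repr
  ev_cover := H.ev_cover
  bad_disj := H.bad_disj
  bad_sub := H.bad_sub
  loc := tEvent_loc hK H.tmpl_meas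
  sym := tEvent_sym H.tmpl_sym
  univ_le := H.univ_le
  r_nonneg := H.r_nonneg

variable {n : ℕ} [NeZero n]

/-- **W4b′'s READING FOR THE `SU(n)` GIBBS TOWER FROM A TEMPLATE SIDE ALONE.** [folklore] -/
theorem TemplateSide.cutoffReading_towerLaw_gibbs_SU (P : Params) {β : ℝ} (hβ : 0 ≤ β)
    (ℰ : ℕ → LoopAverage (Matrix.specialUnitaryGroup (Fin n) ℂ))
    (hE : ∀ k l, Measurable fun W : Fin (l + 1) → Matrix.specialUnitaryGroup (Fin n) ℂ => (ℰ k).E W)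
    {K : ℕ} (hK : K ≤ P.m + P.K) {ev : ι → Set (Tower P (Matrix.specialUnitaryGroup (Fin n) ℂ) K)}
    {obs : Tower P (Matrix.specialUnitaryGroup (Fin n) ℂ) K → ℝ}
    {tmpl : Λ → Set (Tower P (Matrix.specialUnitaryGroup (Fin n) ℂ) K)}
    (H : TemplateSide P (Matrix.specialUnitaryGroup (Fin n) ℂ) K Pat T A Bad
      (towerLaw (T4GenFunBounds.gibbsMeasure (G := Matrix.specialUnitaryGroup (Fin n) ℂ) P β)
        (fun k => blockAvg (P := P) (j := k) (ℰ k)) K) Z ev obs ob tmpl r) :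
    CutoffReading P.d (P.sitesPerDir K) Pat T A Bad
      (towerLaw (T4GenFunBounds.gibbsMeasure (G := Matrix.specialUnitaryGroup (Fin n) ℂ) P β)
        (fun k => blockAvg (P := P) (j := k) (ℰ k)) K)
      Z ev obs ob (fun l c => tEvent K (tmpl l) c) (cutRefl K) (cutPos (Matrix.specialUnitaryGroup (Fin n) ℂ) K) r :=
  (H.eventSide hK).cutoffReading_towerLaw_gibbs_SU P hβ ℰ hE hK

end TemplateSide

section TemplateEnd

variable {ι Λ : Type*} [DecidableEq ι] {Pat : Finset Λ} {n : ℕ} [NeZero n] {T : ℕ → Finset ι} {K₀ : ℕ}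
  {A B shA shB Cc Rr CcRec RrRec : ℕ → ℝ → ι → ℝ}
  {Bad : ℕ → Finset ι} {Z Z' : ℕ → ℝ} {r r' ν u s₂ c₀ rr s Wsh : ℕ → ℝ} {l₀ vol : ℝ}

/-- **THE ROAD'S END OVER THE `SU(n)` GIBBS TOWERS FROM TWO FAMILIES OF TEMPLATE SIDES** — W4c's
`hybridNE7_of_towerEventSides_SU` with, at every cutoff `K ≥ K₀`, the event half replaced by a TEMPLATE side: the three
event-geometry clauses `E_meas`∕`loc`∕`sym` are PRODUCED (W3o), in addition to `prob`, the five RP clauses (W3m), the block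
count transport and `Even N` (W4c).  Nothing PRINTED is asserted; NE7b is NOT proved by this. [folklore] -/
theorem hybridNE7_of_towerTemplateSides_SU (P₀ : Params) {βA βB : ℕ → ℝ} (hβA : ∀ K, 0 ≤ βA K) (hβB : ∀ K, 0 ≤ βB K)
    (ℰA ℰB : ℕ → ℕ → LoopAverage (Matrix.specialUnitaryGroup (Fin n) ℂ))
    (hEA : ∀ K k l, Measurable fun W : Fin (l + 1) → Matrix.specialUnitaryGroup (Fin n) ℂ => (ℰA K k).E W)
    (hEB : ∀ K k l, Measurable fun W : Fin (l + 1) → Matrix.specialUnitaryGroup (Fin n) ℂ => (ℰB K k).E W)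
    {ev : ∀ K, ι → Set (Tower (cutoffParams P₀ K) (Matrix.specialUnitaryGroup (Fin n) ℂ) K)}
    {obs : ∀ K, Tower (cutoffParams P₀ K) (Matrix.specialUnitaryGroup (Fin n) ℂ) K → ℝ} {ob : ℝ}
    {tmpl : ∀ K, Λ → Set (Tower (cutoffParams P₀ K) (Matrix.specialUnitaryGroup (Fin n) ℂ) K)}
    {ev' : ∀ K, ι → Set (Tower (cutoffParams P₀ K) (Matrix.specialUnitaryGroup (Fin n) ℂ) K)}
    {obs' : ∀ K, Tower (cutoffParams P₀ K) (Matrix.specialUnitaryGroup (Fin n) ℂ) K → ℝ}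
    {tmpl' : ∀ K, Λ → Set (Tower (cutoffParams P₀ K) (Matrix.specialUnitaryGroup (Fin n) ℂ) K)}
    (HA : ∀ K, K₀ ≤ K → TemplateSide (cutoffParams P₀ K) (Matrix.specialUnitaryGroup (Fin n) ℂ) K Pat (T K) (A K)
      (Bad K)
      (towerLaw (T4GenFunBounds.gibbsMeasure (G := Matrix.specialUnitaryGroup (Fin n) ℂ) (cutoffParams P₀ K) (βA K))
        (fun k => blockAvg (P := cutoffParams P₀ K) (j := k) (ℰA K k)) K)
      (Z K) (ev K) (obs K) ob (tmpl K) (r K))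
    (HB : ∀ K, K₀ ≤ K → TemplateSide (cutoffParams P₀ K) (Matrix.specialUnitaryGroup (Fin n) ℂ) K Pat (T K) (B K)
      (Bad K)
      (towerLaw (T4GenFunBounds.gibbsMeasure (G := Matrix.specialUnitaryGroup (Fin n) ℂ) (cutoffParams P₀ K) (βB K))
        (fun k => blockAvg (P := cutoffParams P₀ K) (j := k) (ℰB K k)) K)
      (Z' K) (ev' K) (obs' K) ob (tmpl' K) (r' K))
    (hr : Summable r) (hr' : Summable r')
    (hSh : ShellWeightBound l₀ T A B shA shB Wsh)
    (hTB : ReindexedBudget l₀ vol T (fun K t τ => A K t τ - shA K t τ) (fun K t τ => B K t τ - shB K t τ)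
      (fun K _ => Bad K) Cc Rr CcRec RrRec ν u s₂ c₀ rr s)
    (hrr : Summable rr) (hu : Summable u) (hs : Summable s) (hs₂ : Summable s₂) :
    ∃ K₁ K₂, K₀ ≤ K₁ ∧ HybridNE7 l₀ vol (fun K => T (K₁ + (K₂ + K))) (fun K => A (K₁ + (K₂ + K)))
      (fun K => B (K₁ + (K₂ + K))) (fun K _ => Bad (K₁ + (K₂ + K)))
      (fun K => Real.exp (2 * (ob * l₀)) *
        ((#Pat : ℝ) * ((2 * P₀.L ^ P₀.m : ℕ) : ℝ) ^ P₀.d * (r (K₁ + (K₂ + K)) + r' (K₁ + (K₂ + K)))))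
      (fun K => shA (K₁ + (K₂ + K))) (fun K => shB (K₁ + (K₂ + K))) (fun K => Wsh (K₁ + (K₂ + K)))
      (fun K => (rr (K₁ + (K₂ + K)) + u (K₁ + (K₂ + K))) + (s (K₁ + (K₂ + K)) + s₂ (K₁ + (K₂ + K)))) :=
  hybridNE7_of_towerEventSides_SU P₀ hβA hβB ℰA ℰB hEA hEB
    (fun K hK => (HA K hK).eventSide (le_m_add_K_cutoffParams P₀ K))
    (fun K hK => (HB K hK).eventSide (le_m_add_K_cutoffParams P₀ K))
    hr hr' hSh hTB hrr hu hs hs₂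

end TemplateEnd

/-! ## §2 Cube cells -/

section CubeCells

variable {M N K : ℕ}

/-- `cubeCut` is additive. [folklore] -/
theorem cubeCut_add [NeZero N] (h : P.sitesPerDir K = M * N) (a b : ZMod N) :
    cubeCut h (a + b) = cubeCut h a + cubeCut h b := by
  apply ZMod.val_injective
  have hmod : (M * (a.val + b.val)) % P.sitesPerDir K = M * ((a.val + b.val) % N) := by
    rw [h, Nat.mul_mod_mul_left]
  rw [ZMod.val_add, val_cubeCut, val_cubeCut, val_cubeCut, ← mul_add, hmod, ZMod.val_add]

/-- `cubeCut 0 = 0`. [folklore] -/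
theorem cubeCut_zero [NeZero N] (h : P.sitesPerDir K = M * N) : cubeCut h (0 : ZMod N) = 0 := by
  apply ZMod.val_injective
  rw [val_cubeCut, ZMod.val_zero, ZMod.val_zero, mul_zero]

/-- `cubeCut` as an additive homomorphism. -/
def cubeCutHom [NeZero N] (h : P.sitesPerDir K = M * N) : ZMod N →+ ZMod (P.sitesPerDir K) where
  toFun := cubeCut h
  map_zero' := cubeCut_zero h
  map_add' := cubeCut_add h

/-- `cubeCutHom` evaluated. [folklore] -/
@[simp] theorem cubeCutHom_apply [NeZero N] (h : P.sitesPerDir K = M * N) (k : ZMod N) : cubeCutHom h k = cubeCut h k :=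
  rfl

/-- the first cube boundary is the unit hyperplane `M`: `cubeCut h 1 = M` (also when `N = 1`, both sides `0`). [folklore] -/
theorem cubeCut_one [NeZero N] (h : P.sitesPerDir K = M * N) :
    cubeCut h (1 : ZMod N) = (M : ZMod (P.sitesPerDir K)) := by
  apply ZMod.val_injective
  rw [val_cubeCut, ZMod.val_natCast, ZMod.val_one_eq_one_mod, ← Nat.mul_mod_mul_left, mul_one, ← h]

/-- **THE CORNER SITE OF THE CUBE `c`**: coordinatewise `cubeCut h (c μ)` (= `M·c`); the cube `c` is the box of side `M`
at this corner, so its column events are W3o's template events at `cubeCorner h c`. -/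
def cubeCorner (h : P.sitesPerDir K = M * N) (c : BlockIdx P.d N) : Site P K := fun μ => cubeCut h (c μ)

/-- the `i`-label of the cube corner relative to the cube cut `k`: `M·(c i − k).val`. [folklore] -/
theorem val_cubeCorner_sub_cutVec [NeZero N] (h : P.sitesPerDir K = M * N) (c : BlockIdx P.d N) (i : Fin P.d)
    (k : ZMod N) : ((cubeCorner h c - cutVec K i (cubeCut h k)) i).val = M * (c i - k).val := by
  rw [site_sub_apply]
  simp only [cubeCorner, cutVec, Pi.single_eq_same]
  rw [← cubeCutHom_apply, ← cubeCutHom_apply, ← map_sub, cubeCutHom_apply, val_cubeCut]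

variable [MeasurableSpace G] {Λ : Type*} {Pat : Finset Λ} {tmpl : Λ → Set (Tower P G K)}

/-- **`EventSide.loc` FOR TEMPLATE EVENTS ON CUBE CELLS** (`mP := cubePos G h`): templates measurable in the reference
column under the top cube of side `M` give `cubePos`-measurable events at every positive-half cube. [folklore] -/
theorem tEvent_loc_cubes [NeZero N] (hK : K ≤ P.m + P.K) (h : P.sitesPerDir K = M * N)
    (htm : ∀ l ∈ Pat, MeasurableSet[towerBox G K M K] (tmpl l)) :
    ∀ l ∈ Pat, ∀ (i : Fin P.d) (k : ZMod N), ∀ c ∈ halfPlus N i k,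
      MeasurableSet[cubePos G h i k] (tEvent K (tmpl l) (cubeCorner h c)) := by
  intro l hl i k c hc
  rw [mem_halfPlus] at hc
  refine measurableSet_tEvent_cutPos hK (htm l hl) ?_
  rw [val_cubeCorner_sub_cutVec, h]
  calc M * (c i - k).val + M = M * ((c i - k).val + 1) := by ring
    _ ≤ M * (N / 2) := Nat.mul_le_mul_left _ (by omega)
    _ ≤ M * N / 2 := by
        refine (Nat.le_div_iff_mul_le two_pos).2 ?_
        calc M * (N / 2) * 2 = M * (N / 2 * 2) := by ring
          _ ≤ M * N := Nat.mul_le_mul_left _ (Nat.div_mul_le_self N 2)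

variable [GaugeGroup G]

omit [MeasurableSpace G] in
/-- the vector identity of the cube case: `−M·e_i + (σ_i (M·c − M·k·e_i) + M·k·e_i) = M·(cellReflect i k c)`. [folklore] -/
theorem cubeCorner_cellReflect [NeZero N] (h : P.sitesPerDir K = M * N) (i : Fin P.d) (k : ZMod N) (c : BlockIdx P.d N) :
    -axisVec P K i M + ((cubeCorner h c + -cutVec K i (cubeCut h k)).reflect i + cutVec K i (cubeCut h k)) =
      cubeCorner h (cellReflect i k c) := by
  funext μ
  by_cases hμ : μ = i
  · subst hμ
    simp only [Site.add_apply, site_neg_apply, Site.reflect_apply, if_true, cubeCorner, cellReflect_apply,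
      Function.update_self, cutVec, Pi.single_eq_same, axisVec_apply]
    rw [← cubeCut_one h, ← cubeCutHom_apply, ← cubeCutHom_apply, ← cubeCutHom_apply, ← cubeCutHom_apply, two_mul,
      map_sub, map_sub, map_add]
    ring
  · simp only [Site.add_apply, site_neg_apply, Site.reflect_apply, if_neg hμ, cubeCorner, cellReflect_apply,
      Function.update_of_ne hμ, cutVec, Pi.single_eq_of_ne hμ, axisVec_apply]
    ring

omit [MeasurableSpace G] in
/-- **`EventSide.sym` FOR TEMPLATE EVENTS ON CUBE CELLS** (`θ := cubeRefl h`): templates with the cube reflection symmetry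
`(towerRefl i K)⁻¹' tmpl = (towerTranslate K (−M·e_i))⁻¹' tmpl` («the reflected template is the template carried to the
mirror CUBE»; W3o-3's `boxUniform_sym` supplies it for the uniform box templates) give reflection-related events at every
cube boundary. [folklore] -/
theorem tEvent_sym_cubes [NeZero N] (h : P.sitesPerDir K = M * N)
    (hR : ∀ l ∈ Pat, ∀ i : Fin P.d,
      (towerRefl i K) ⁻¹' tmpl l = (towerTranslate K (-axisVec P K i M)) ⁻¹' tmpl l) :
    ∀ l ∈ Pat, ∀ (i : Fin P.d) (k : ZMod N) (c : BlockIdx P.d N),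
      (cubeRefl h i k) ⁻¹' tEvent K (tmpl l) (cubeCorner h c) = tEvent K (tmpl l) (cubeCorner h (cellReflect i k c)) := by
  intro l hl i k c
  rw [cubeRefl_eq, preimage_cutRefl_tEvent (hR l hl i) (cubeCut h k) (cubeCorner h c), cubeCorner_cellReflect]

omit [GaugeGroup G] in
/-- **`EventSide.E_meas` FOR TEMPLATE EVENTS ON CUBE CELLS.** [folklore] -/
theorem tEvent_E_meas_cubes (h : P.sitesPerDir K = M * N) (htm : ∀ l ∈ Pat, MeasurableSet (tmpl l)) :
    ∀ l ∈ Pat, ∀ c : BlockIdx P.d N, MeasurableSet (tEvent K (tmpl l) (cubeCorner h c)) :=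
  fun l hl c => measurableSet_tEvent (htm l hl) (cubeCorner h c)

end CubeCells

/-! ## §3 Sanity in situ -/

section TemplateSanity

variable {n : ℕ} [NeZero n]

/-- NON-VACUITY IN SITU: the template side is INHABITED on the actual Gibbs tower (one pattern with the full template
`univ`, one term `univ` of weight `Z = 1`, empty bad class, source `0`, rate `1`). -/
example (P : Params) (β : ℝ) (ℰ : ℕ → LoopAverage (Matrix.specialUnitaryGroup (Fin n) ℂ))
    (hE : ∀ k l, Measurable fun W : Fin (l + 1) → Matrix.specialUnitaryGroup (Fin n) ℂ => (ℰ k).E W)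
    (hβ : 0 ≤ β) (K : ℕ) :
    TemplateSide P (Matrix.specialUnitaryGroup (Fin n) ℂ) K ({()} : Finset Unit) ({()} : Finset Unit)
      (fun _ _ => (1 : ℝ)) (∅ : Finset Unit)
      (towerLaw (T4GenFunBounds.gibbsMeasure (G := Matrix.specialUnitaryGroup (Fin n) ℂ) P β)
        (fun k => blockAvg (P := P) (j := k) (ℰ k)) K)
      1 (fun _ => Set.univ) (fun _ => 0) 0 (fun _ => Set.univ) 1 := by
  haveI := T4GenFunBounds.isProbabilityMeasure_gibbsMeasure (G := Matrix.specialUnitaryGroup (Fin n) ℂ) P hβ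
  haveI := isProbabilityMeasure_towerLaw (P := P) (av := fun k => blockAvg (P := P) (j := k) (ℰ k))
    (fun k => measurable_avgFun (ℰ k) (hE k))
    (T4GenFunBounds.gibbsMeasure (G := Matrix.specialUnitaryGroup (Fin n) ℂ) P β) K
  exact
  { Z_pos := one_pos
    bad_subset := Finset.empty_subset _
    ev_meas := fun _ _ => MeasurableSet.univ
    obs_meas := measurable_const
    obs_bdd := fun _ => by simp
    ob_nonneg := le_rfl
    repr := fun t τ _ => by simp [Measure.restrict_univ]
    ev_cover := fun ω _ => Set.mem_iUnion₂.2 ⟨(), Finset.mem_singleton_self _, Set.mem_univ ω⟩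
    bad_disj := by simp
    bad_sub := by simp
    univ_le := fun _ _ => (measureReal_mono (Set.subset_univ _) (measure_ne_top _ _)).trans_eq (by simp)
    r_nonneg := zero_le_one
    tmpl_meas := fun _ _ => MeasurableSet.univ
    tmpl_sym := fun _ _ _ => rfl }

end TemplateSanity

section Junction

variable {n : ℕ} [NeZero n]

/-- IN SITU, HYPOTHESIS-FREE: on `Tower P SU(n) K` with the Gibbs tower law of Bałaban's block averagings, for the
UNIFORM BOX TEMPLATE «every bond of the column under the cell lies in `A`» (W3o-3's `boxUniform P G A K 1 K`; `A`
measurable and inversion-symmetric — e.g. a small-field condition per bond), file 4a's `EventSide` holds with its three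
event-geometry clauses `E_meas` ∕ `loc` ∕ `sym` DISCHARGED by W3o's `tEvent_E_meas` ∕ `tEvent_loc` ∕ `tEvent_sym` fed by
W3o-3's `measurableSet_boxUniform` ∕ `boxUniform_sym_cell` (one pattern; one term `univ`, empty bad class, rate `1`). -/
example (P : Params) {β : ℝ} (hβ : 0 ≤ β)
    (ℰ : ℕ → LoopAverage (Matrix.specialUnitaryGroup (Fin n) ℂ))
    (hE : ∀ k l, Measurable fun W : Fin (l + 1) → Matrix.specialUnitaryGroup (Fin n) ℂ => (ℰ k).E W) {K : ℕ}
    (hK : K ≤ P.m + P.K) {A : Set (Matrix.specialUnitaryGroup (Fin n) ℂ)} (hAm : MeasurableSet A)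
    (hA : ∀ g : Matrix.specialUnitaryGroup (Fin n) ℂ, g⁻¹ ∈ A ↔ g ∈ A) :
    EventSide P.d (P.sitesPerDir K) ({()} : Finset Unit) ({()} : Finset Unit) (fun _ _ => (1 : ℝ)) (∅ : Finset Unit)
      (towerLaw (T4GenFunBounds.gibbsMeasure (G := Matrix.specialUnitaryGroup (Fin n) ℂ) P β)
        (fun k => blockAvg (P := P) (j := k) (ℰ k)) K)
      1 (fun _ => Set.univ) (fun _ => 0) 0
      (fun _ c => tEvent K (boxUniform P (Matrix.specialUnitaryGroup (Fin n) ℂ) A K 1 K) c) (cutRefl K)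
      (cutPos (Matrix.specialUnitaryGroup (Fin n) ℂ) K) 1 := by
  haveI := T4GenFunBounds.isProbabilityMeasure_gibbsMeasure (G := Matrix.specialUnitaryGroup (Fin n) ℂ) P hβ
  haveI := isProbabilityMeasure_towerLaw (P := P) (av := fun k => blockAvg (P := P) (j := k) (ℰ k))
    (fun k => measurable_avgFun (ℰ k) (hE k))
    (T4GenFunBounds.gibbsMeasure (G := Matrix.specialUnitaryGroup (Fin n) ℂ) P β) K
  exact
  { Z_pos := one_pos
    bad_subset := Finset.empty_subset _
    ev_meas := fun _ _ => MeasurableSet.univ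
    E_meas := tEvent_E_meas fun _ _ => measurableSet_of_towerBox (measurableSet_boxUniform hAm K 1 K)
    obs_meas := measurable_const
    obs_bdd := fun _ => by simp
    ob_nonneg := le_rfl
    repr := fun t τ _ => by simp [Measure.restrict_univ]
    ev_cover := fun ω _ => Set.mem_iUnion₂.2 ⟨(), Finset.mem_singleton_self _, Set.mem_univ ω⟩
    bad_disj := by simp
    bad_sub := by simp
    loc := tEvent_loc hK fun _ _ => measurableSet_boxUniform hAm K 1 K
    sym := tEvent_sym fun _ _ i => boxUniform_sym_cell hA hK i
    univ_le := fun _ _ => (measureReal_mono (Set.subset_univ _) (measure_ne_top _ _)).trans_eq (by simp)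
    r_nonneg := zero_le_one }

end Junction

end

end Summit.QuantumFields.BalabanUV.T4Continuum.HistoryChessboardEventsTemplates
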